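import Summits.AnomalousDissipation.AnomalousDissipation.Theorems.SolenoidalFractalHomogenisationRealisedQuasiStaticCellLawSectorDecayAE
import HarnessLib

/-!
# K2R `RealisedQuasiStaticCellLaw`, line `floquet-bloch`: the low-sector decay with a CAPPED contraction factor — prefactor
# control (helper towards `stub_lowSectorDecay`; `--supports stmt-AnomalousDissipation-20446`)

Summits-side helper file (everything proved; no definitions, no named facts). `sectorDecay_ae` gives
`∫‖w(t)‖² ≤ θ₀⁻¹ e^{-(log θ₀⁻¹/P) t} ∫‖w₀‖²` with the per-period factor `θ₀`; when `θ₀` is very small the prefactor `θ₀⁻¹` is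
large. Since the energy is also non-increasing, for ANY `θ ∈ [θ₀, 1]` one has the better-shaped bound
`∫‖w(t)‖² ≤ θ⁻¹ e^{-(log θ⁻¹/P) t} ∫‖w₀‖²` (`sectorDecay_ae_cap`): trading rate for prefactor, which is how the crux's prefactor
`K/ν` is met (recipe v2 §(ii)). The key real-variable fact is `exp_decay_cap`.
-/

set_option linter.dupNamespace false

noncomputable section

namespace Summit.AnomalousDissipation.AnomalousDissipation.Theorems.SolenoidalFractalHomogenisation.RealisedQuasiStaticCellLaw

open Set MeasureTheory Filter Topology Function Matrix
open scoped InnerProductSpace ComplexConjugate Matrix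
open Literature.Analysis Literature.Analysis.FunctionSpaces Literature.Analysis.FunctionSpaces.Torus
open Literature.Analysis.FluidPDE Literature.Analysis.FluidPDE.LatticeShear

variable {k₀ : ℕ}

/-- **Trading rate for prefactor.** For `0 < θ₀ ≤ θ ≤ 1`, `P > 0` and any real `t`:
`min 1 (θ₀⁻¹ e^{-(log θ₀⁻¹/P) t}) ≤ θ⁻¹ e^{-(log θ⁻¹/P) t}`. -/
theorem exp_decay_cap {θ₀ θ P : ℝ} (t : ℝ) (hθ₀ : 0 < θ₀) (hθ₀θ : θ₀ ≤ θ) (hθ1 : θ ≤ 1) (hP : 0 < P) :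
    min 1 (θ₀⁻¹ * Real.exp (-(Real.log θ₀⁻¹ / P) * t)) ≤ θ⁻¹ * Real.exp (-(Real.log θ⁻¹ / P) * t) := by
  have hθ : 0 < θ := hθ₀.trans_le hθ₀θ
  have hL : 0 ≤ Real.log θ⁻¹ := Real.log_nonneg (one_le_inv_iff₀.2 ⟨hθ, hθ1⟩)
  have hL0 : Real.log θ⁻¹ ≤ Real.log θ₀⁻¹ :=
    Real.log_le_log (inv_pos.2 hθ) (inv_anti₀ hθ₀ hθ₀θ)
  -- both sides as single exponentials
  have e1 : θ⁻¹ * Real.exp (-(Real.log θ⁻¹ / P) * t) = Real.exp (Real.log θ⁻¹ * (1 - t / P)) := by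
    rw [show θ⁻¹ * Real.exp (-(Real.log θ⁻¹ / P) * t) =
        Real.exp (Real.log θ⁻¹) * Real.exp (-(Real.log θ⁻¹ / P) * t) by rw [Real.exp_log (inv_pos.2 hθ)],
      ← Real.exp_add]
    congr 1; field_simp; ring
  have e0 : θ₀⁻¹ * Real.exp (-(Real.log θ₀⁻¹ / P) * t) = Real.exp (Real.log θ₀⁻¹ * (1 - t / P)) := by
    rw [show θ₀⁻¹ * Real.exp (-(Real.log θ₀⁻¹ / P) * t) =
        Real.exp (Real.log θ₀⁻¹) * Real.exp (-(Real.log θ₀⁻¹ / P) * t) by rw [Real.exp_log (inv_pos.2 hθ₀)],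
      ← Real.exp_add]
    congr 1; field_simp; ring
  rw [e1, e0]
  by_cases htP : t ≤ P
  · -- before one period the right side is at least `1`
    refine (min_le_left _ _).trans ?_
    have : 0 ≤ Real.log θ⁻¹ * (1 - t / P) := mul_nonneg hL (by rw [sub_nonneg, div_le_one hP]; exact htP)
    calc (1 : ℝ) = Real.exp 0 := (Real.exp_zero).symm
      _ ≤ Real.exp (Real.log θ⁻¹ * (1 - t / P)) := Real.exp_le_exp.2 this
  · push Not at htP
    refine (min_le_right _ _).trans (Real.exp_le_exp.2 ?_)
    have hneg : 1 - t / P ≤ 0 := by rw [sub_nonpos, one_le_div hP]; exact htP.le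
    nlinarith

/-- **Low-sector decay with a capped contraction factor**: the conclusion of `sectorDecay_ae` with `θ₀` replaced by any
`θ ∈ [θ₀, 1]`. -/
theorem sectorDecay_ae_cap (W : LatticeWord k₀) {n : ℕ} (hn : 0 < n) {κ : ℝ} (hκ : 0 < κ)
    (ℓ : Fin 3 → ℤ) (hℓn : 2 * ‖latticeVec ℓ‖ ≤ n) {w₀ : UnitAddTorus (Fin 3) → EuclideanSpace ℝ (Fin 3)}
    (hw₀ : FunctionSpaces.Torus.MemSobolev 1 (FunctionSpaces.EuclideanSpace.complexify ∘ w₀))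
    (hdiv : FunctionSpaces.Torus.IsWeaklyDivFree w₀) (hmean : FunctionSpaces.Torus.HasZeroMean w₀)
    (hsupp : ∀ k : Fin 3 → ℤ, ¬ ((∃ z : Fin 3 → ℤ, k = ℓ + (n:ℤ) • z) ∨ (∃ z : Fin 3 → ℤ, k = -ℓ + (n:ℤ) • z)) →
      UnitAddTorus.mFourierCoeff (FunctionSpaces.EuclideanSpace.complexify ∘ w₀) k = 0)
    (j : Fin k₀) (hk : ∀ J : ℤ, ℓ + J • (fun i => (W.phase j).m i * (n : ℤ)) ≠ 0)
    {ζr : Fin 3 → ℝ} (hζ1 : ζr ⬝ᵥ ζr = 1) (hζ0 : ζr ⬝ᵥ (fun i => ((ℓ i : ℤ) : ℝ)) = 0)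
    (hζK : ζr ⬝ᵥ (fun i => (((fun i => (W.phase j).m i * (n : ℤ)) i : ℤ) : ℝ)) = 0)
    {p : ℤ → Fin 3 → ℝ}
    (hp : ∀ J : ℤ, p J = (Real.sqrt ((fun i => (((ℓ + J • (fun i => (W.phase j).m i * (n : ℤ))) i : ℤ) : ℝ)) ⬝ᵥ
        (fun i => (((ℓ + J • (fun i => (W.phase j).m i * (n : ℤ))) i : ℤ) : ℝ))))⁻¹ •
        (fun i => (((ℓ + J • (fun i => (W.phase j).m i * (n : ℤ))) i : ℤ) : ℝ)) ⨯₃ ζr)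
    (hs : ∀ J : ℤ, |p J ⬝ᵥ p (J + 1)| ≤ 1) (hγpos : 0 < (p 0 ⬝ᵥ p 1) ^ 2 + (p (-1) ⬝ᵥ p 0) ^ 2)
    (hd0 : freqNormSq ℓ / freqNormSq (fun i => (W.phase j).m i * (n : ℤ)) ≤ 1)
    (hd : ∀ J : ℤ, J ≠ 0 →
      1 / 2 ≤ freqNormSq (ℓ + J • (fun i => (W.phase j).m i * (n : ℤ))) / freqNormSq (fun i => (W.phase j).m i * (n : ℤ)))
    (hd1 : freqNormSq (ℓ + (1 : ℤ) • (fun i => (W.phase j).m i * (n : ℤ))) /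
      freqNormSq (fun i => (W.phase j).m i * (n : ℤ)) ≤ 2)
    (hdm1 : freqNormSq (ℓ + (-1 : ℤ) • (fun i => (W.phase j).m i * (n : ℤ))) /
      freqNormSq (fun i => (W.phase j).m i * (n : ℤ)) ≤ 2)
    (hθ : 0 < ∑ i, (W.phase j).e i * (ℓ i : ℝ))
    {T : ℝ} (hT : 0 < T) {w : ℝ → UnitAddTorus (Fin 3) → EuclideanSpace ℝ (Fin 3)}
    (hw : Torus.IsWeakPassiveVectorOn 0 T κ (W.cell n) w₀ w)
    {θ : ℝ} (hθ₀θ : (min 1 (max (2 * (5 / 3) * Real.exp (-(κ * (4 * Real.pi ^ 2 * freqNormSq (fun i => (W.phase j).m i * (n : ℤ))) *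
            min 2 ((p 0 ⬝ᵥ p 1) ^ 2 + (p (-1) ⬝ᵥ p 0) ^ 2) *
            (2 * Real.pi * (∑ i, (W.phase j).e i * (ℓ i : ℝ)) *
              ‖Complex.exp ((W.phase j).φ * Complex.I) *
                (1 / (2 * ((2 * Real.pi * ‖latticeVec (W.phase j).m‖ : ℝ) : ℂ) * Complex.I))‖ * (1 / (n : ℝ)) /
              (κ * (4 * Real.pi ^ 2 * freqNormSq (fun i => (W.phase j).m i * (n : ℤ)))) / 2) *
            min (2 * Real.pi * (∑ i, (W.phase j).e i * (ℓ i : ℝ)) *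
              ‖Complex.exp ((W.phase j).φ * Complex.I) *
                (1 / (2 * ((2 * Real.pi * ‖latticeVec (W.phase j).m‖ : ℝ) : ℂ) * Complex.I))‖ * (1 / (n : ℝ)) /
              (κ * (4 * Real.pi ^ 2 * freqNormSq (fun i => (W.phase j).m i * (n : ℤ)))) / 2)
              (2 * Real.pi * (∑ i, (W.phase j).e i * (ℓ i : ℝ)) *
              ‖Complex.exp ((W.phase j).φ * Complex.I) *
                (1 / (2 * ((2 * Real.pi * ‖latticeVec (W.phase j).m‖ : ℝ) : ℂ) * Complex.I))‖ * (1 / (n : ℝ)) /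
              (κ * (4 * Real.pi ^ 2 * freqNormSq (fun i => (W.phase j).m i * (n : ℤ)))))⁻¹ / 80) *
              ((W.phase j).τ * (1 - W.ramp))))
          (Real.exp (-(8 * Real.pi ^ 2 * κ * ((n : ℝ) / 2) ^ 2) * ((W.phase j).τ * (1 - W.ramp)))))) ≤ θ) (hθ1 : θ ≤ 1) :
    ∀ᵐ t ∂(volume.restrict (Ioo 0 T)), ∫ x, ‖w t x‖ ^ 2 ≤
      θ⁻¹ * Real.exp (-(Real.log θ⁻¹ / W.period) * t) * ∫ x, ‖w₀ x‖ ^ 2 := by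
  classical
  set hPV := pvSetup_cell W hn hκ.le ℓ hw₀ hdiv hmean hsupp with hPVdef
  set K : Fin 3 → ℤ := fun i => (W.phase j).m i * (n : ℤ) with hK
  have hK0 : K ≠ 0 := cellFreq_ne_zero (W.phase j) hn
  obtain ⟨θ₀, hθ₀⟩ : ∃ θ₀ : ℝ, θ₀ = (min 1 (max (2 * (5 / 3) * Real.exp (-(κ * (4 * Real.pi ^ 2 * freqNormSq K) *
            min 2 ((p 0 ⬝ᵥ p 1) ^ 2 + (p (-1) ⬝ᵥ p 0) ^ 2) *
            (2 * Real.pi * (∑ i, (W.phase j).e i * (ℓ i : ℝ)) *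
              ‖Complex.exp ((W.phase j).φ * Complex.I) *
                (1 / (2 * ((2 * Real.pi * ‖latticeVec (W.phase j).m‖ : ℝ) : ℂ) * Complex.I))‖ * (1 / (n : ℝ)) /
              (κ * (4 * Real.pi ^ 2 * freqNormSq K)) / 2) *
            min (2 * Real.pi * (∑ i, (W.phase j).e i * (ℓ i : ℝ)) *
              ‖Complex.exp ((W.phase j).φ * Complex.I) *
                (1 / (2 * ((2 * Real.pi * ‖latticeVec (W.phase j).m‖ : ℝ) : ℂ) * Complex.I))‖ * (1 / (n : ℝ)) /
              (κ * (4 * Real.pi ^ 2 * freqNormSq K)) / 2)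
              (2 * Real.pi * (∑ i, (W.phase j).e i * (ℓ i : ℝ)) *
              ‖Complex.exp ((W.phase j).φ * Complex.I) *
                (1 / (2 * ((2 * Real.pi * ‖latticeVec (W.phase j).m‖ : ℝ) : ℂ) * Complex.I))‖ * (1 / (n : ℝ)) /
              (κ * (4 * Real.pi ^ 2 * freqNormSq K)))⁻¹ / 80) *
              ((W.phase j).τ * (1 - W.ramp))))
          (Real.exp (-(8 * Real.pi ^ 2 * κ * ((n : ℝ) / 2) ^ 2) * ((W.phase j).τ * (1 - W.ramp)))))) := ⟨_, rfl⟩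
  rw [← hθ₀] at hθ₀θ
  have hθ₀pos : 0 < θ₀ := by rw [hθ₀]; exact lt_min one_pos (lt_max_of_lt_right (Real.exp_pos _))
  have hP := Summit.AnomalousDissipation.AnomalousDissipation.Theorems.SolenoidalFractalHomogenisation.PermissibleCarrier.period_pos W
  have hE0 : 0 ≤ ∫ x, ‖w₀ x‖ ^ 2 := integral_nonneg fun x => by positivity
  -- eventually in `N`: the carrier and `ℓ, ℓ ± K` are resolved
  have hev : ∀ᶠ N : ℕ in atTop, (Finset.univ.biUnion fun j : Fin k₀ =>
        ({(fun i => (W.phase j).m i * n), -(fun i => (W.phase j).m i * n)} : Finset (Fin 3 → ℤ))) ⊆ freqBall N ∧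
      ℓ + (0 : ℤ) • K ∈ freqBall N ∧ ℓ + (1 : ℤ) • K ∈ freqBall N ∧ ℓ + (-1 : ℤ) • K ∈ freqBall N := by
    have h1 : ∀ᶠ N : ℕ in atTop, ∀ k ∈ (Finset.univ.biUnion fun j : Fin k₀ =>
        ({(fun i => (W.phase j).m i * n), -(fun i => (W.phase j).m i * n)} : Finset (Fin 3 → ℤ))), k ∈ freqBall N :=
      (Filter.eventually_all_finset _).2 fun k _ => eventually_mem_freqBall k
    filter_upwards [h1, eventually_mem_freqBall (ℓ + (0 : ℤ) • K), eventually_mem_freqBall (ℓ + (1 : ℤ) • K),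
      eventually_mem_freqBall (ℓ + (-1 : ℤ) • K)] with N hN h0 h1' hm1
    exact ⟨fun k hk' => hN k hk', h0, h1', hm1⟩
  -- the uniform bound on the truncations, capped
  have hΦ : ∀ᶠ N in atTop, ∀ t, 0 ≤ t →
      ∑ k, ‖hPV.galerkinCoeff N t k‖ ^ 2 ≤ θ⁻¹ * Real.exp (-(Real.log θ⁻¹ / W.period) * t) * ∫ x, ‖w₀ x‖ ^ 2 := by
    filter_upwards [hev] with N hN
    intro t ht
    obtain ⟨hBN, hℓ0, hℓ1, hℓm1⟩ := hN
    obtain ⟨Wset, hW⟩ := exists_cosetIndexSet hK0 ℓ N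
    have hdec := sectorEnergy_exp_decay W hn hκ ℓ hℓn hw₀ hdiv hmean hsupp hBN j (fun J _ => hk J) hζ1 hζ0 hζK hp hW
      ((hW 0).2 hℓ0) ((hW 1).2 hℓ1) ((hW (-1)).2 hℓm1) (fun J _ => hs J) hγpos hd0 (fun J _ hJ0 => hd J hJ0) hd1 hdm1 hθ ht
    rw [← hθ₀] at hdec
    have hmono := totalEnergy_antitone W hn hκ.le ℓ hw₀ hdiv hmean hsupp N le_rfl ht
    have hsum : ∀ τ, ∑ k ∈ freqBall N, ‖hPV.galerkinCoeffAt N τ k‖ ^ 2 = ∑ k, ‖hPV.galerkinCoeff N τ k‖ ^ 2 := by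
      intro τ
      rw [← Finset.sum_coe_sort]
      exact Finset.sum_congr rfl fun k _ => by rw [Torus.PVSetup.galerkinCoeffAt, coeffExt_coe]
    rw [hsum t, hsum 0] at hdec hmono
    have hinit : ∑ k, ‖hPV.galerkinCoeff N 0 k‖ ^ 2 ≤ ∫ x, ‖w₀ x‖ ^ 2 := hPV.sum_norm_sq_galerkinCoeff_le N le_rfl
    have hE00 : 0 ≤ ∑ k, ‖hPV.galerkinCoeff N 0 k‖ ^ 2 := Finset.sum_nonneg fun k _ => by positivity
    have hcap := exp_decay_cap t hθ₀pos hθ₀θ hθ1 hP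
    -- `E(t) ≤ min 1 (θ₀⁻¹ e^{…}) · E(0) ≤ θ⁻¹ e^{…} · E(0) ≤ θ⁻¹ e^{…} · ∫‖w₀‖²`
    have h1 : ∑ k, ‖hPV.galerkinCoeff N t k‖ ^ 2 ≤
        min 1 (θ₀⁻¹ * Real.exp (-(Real.log θ₀⁻¹ / W.period) * t)) * ∑ k, ‖hPV.galerkinCoeff N 0 k‖ ^ 2 := by
      rw [min_mul_of_nonneg _ _ hE00, one_mul]
      exact le_min hmono hdec
    have hfac : 0 ≤ θ⁻¹ * Real.exp (-(Real.log θ⁻¹ / W.period) * t) := by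
      have : 0 < θ := hθ₀pos.trans_le hθ₀θ
      positivity
    exact h1.trans ((mul_le_mul_of_nonneg_right hcap hE00).trans (mul_le_mul_of_nonneg_left hinit hfac))
  exact ae_integral_norm_sq_le_of_galerkinBound W hn hκ ℓ hw₀ hdiv hmean hsupp hΦ hT hw

end Summit.AnomalousDissipation.AnomalousDissipation.Theorems.SolenoidalFractalHomogenisation.RealisedQuasiStaticCellLaw

end
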